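import Literature.IUT.LogVolume.Corollary22TwoAdicIntegrality
import Literature.IUT.LogVolume.Corollary22PartI
import Literature.IUT.LogVolume.Corollary22HeightJ
import HarnessLib

/-!
# [IUTchIV] Corollary 2.2 (i) — PROVED: `Cor22.PartI D` for every `K_V` satisfying the hypotheses of Cor. 2.2

Mochizuki, *Inter-universal Teichmüller theory IV*, RIMS manuscript (Apr. 2020; = PRIMS **57** (2021)),
Cor. 2.2 (i), p. 41: "we have three equalities of BD-classes `(1/6)·log(q^{∤2}) ≈ (1/6)·log(q^∀) ≈ (1/6)·ht_∞ ≈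
ht_{ω_X(D)}` on `K_V`". All three are now kernel-checked, by three files of the abc-iut cell:
`Cor22.partI_first` (`Corollary22TwoAdicIntegrality.lean`, seat S-d2: from (∗^{j-inv}) via integrality of
`2^a·j` at all places over `2`, unconditionally), `Cor22.partI_middle` (`Corollary22PartI.lean`: the finite part
of `h(j(λ))` is `[F:ℚ]·log q^∀`, the archimedean part is bounded on `K_∞`), `Cor22.partI_third`
(`Corollary22HeightJ.lean`: `h(j(λ)) = 6·h(λ) + O([F:ℚ])`). This file is the one-line assembly
`Cor22.partI_holds : Hypotheses D → PartI D`. Classical and undisputed (no Θ-data involved); Cor. 2.2 (ii),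
(iii) and anything on [IUTchIII] Cor. 3.12 are untouched.
-/

noncomputable section

namespace Literature.IUT.LogVolume

namespace Cor22

open Literature.NumberTheory.DiophantineGeometry.GenEll

/-- **[IUTchIV] Cor. 2.2 (i), PROVED**: for every compactly bounded subset `K_V ⊆ U_X(ℚ̄)` whose support
contains `2` and which satisfies (∗^{j-inv}), the three equalities of BD-classes
`(1/6)·log(q^{∤2}) ≈ (1/6)·log(q^∀) ≈ (1/6)·ht_∞ ≈ ht_{ω_X(D)}` hold on `K_V` (`Cor22.PartI D`).
[claim: Mochizuki2012, status: disputed] -/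
theorem partI_holds (D : CBData) (hD : Hypotheses D) : PartI D :=
  ⟨partI_first hD, partI_middle D, partI_third D⟩

/-- Hence the hypotheses `PartI D` of `bdLe_of_corollary22` / `Corollary23Chain` are discharged: Cor. 2.2 for
`K_V` reduces to its parts (ii) and (iii). [claim: Mochizuki2012, status: disputed] -/
theorem corollary22_iff_parts (Hunif : ℝ) :
    Corollary22 Hunif ↔ 0 < Hunif ∧ ∀ D : CBData, Hypotheses D → PartII D Hunif ∧ PartIII D Hunif := by
  unfold Corollary22
  constructor
  · rintro ⟨hH, h⟩
    exact ⟨hH, fun D hD => ⟨(h D hD).2.1, (h D hD).2.2⟩⟩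
  · rintro ⟨hH, h⟩
    exact ⟨hH, fun D hD => ⟨partI_holds D hD, (h D hD).1, (h D hD).2⟩⟩

end Cor22

end Literature.IUT.LogVolume

end
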